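import Literature.NumberTheory.GaussSums.PAdicStationaryPhase

/-!
# Proof of the periodized stationary phase formula for `m = 2j` (Dąbrowski–Fisher, Thm 1.8 (a))

Sibling proofs file of `Literature/NumberTheory/GaussSums/PAdicStationaryPhase.lean`: it
discharges the named fact `Literature.NumberTheory.GaussSums.DabrowskiFisher1997_even`
(R. Dąbrowski, B. Fisher, *A stationary phase formula for exponential sums over `ℤ/p^mℤ` and
applications to GL(3)-Kloosterman sums*, Acta Arith. 80 (1997) 1–48 [DabrowskiFisher1997],
THEOREM 1.8 (a), p. 10, case `m = 2j`, for `V = 𝔸ⁿ_ℤ`) as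
`DabrowskiFisher1997_even_holds : DabrowskiFisher1997_even`, with no hypotheses added.

## The argument (as printed: proof of Theorem 1.8 (a), p. 10, and Remark 1.9 (2), p. 11)

Write a point of the fibre over `x̄` as `x' = x + h` with every `h_i ≡ 0 (mod p^j)`; the
second-order Taylor expansion
`f(x + h) = f(x) + Σ_i ∂_i f(x) h_i + O(h²)`
shows `f(x') ≡ f(x) (mod p^{2j})`, because `h_i h_k ≡ 0 (mod p^{2j})` and, `x̄` being critical,
`∂_i f(x) ≡ 0 (mod p^j)` so that `∂_i f(x) h_i ≡ 0 (mod p^{2j})`.  Hence every term of `S_x̄`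
equals `e(f(x)/p^{2j})`, and the fibre has `(p^j)^n = p^{nj}` points.

Lemma structure: `aeval_add_sub_sub_sum_mem_sq` (Taylor to second order along an ideal, by
`MvPolynomial.induction_on`; Mathlib has the one-variable `Polynomial.eval_add_of_sq_eq_zero`
only), `pow_prime_pow_sq_eq_zero` and `exists_eq_pow_mul_of_redPow_eq_zero` (the square-zero
element `p^j` and the kernel of the reduction `ℤ/p^{2j} → ℤ/p^j`),
`aeval_eq_aeval_of_critical` (the phase is constant on a critical fibre),
`card_filter_redPow_eq` / `card_fibre_eq_pow` (fibre count, via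
`AddMonoidHom.card_fiber_eq_of_mem_range`), then the theorem.

NOT here: the first sentence of (a) (`DabrowskiFisher1997_fibre_eq_zero`, non-critical fibres)
and the odd case `m = 2j + 1`.
-/

namespace Literature.NumberTheory.GaussSums

open scoped BigOperators

open MvPolynomial in
/-- **Second-order Taylor expansion along an ideal.** For a polynomial `f` over `R`, an
`R`-algebra `A`, an ideal `I ⊆ A` and points `x, h : σ → A` with all `h i ∈ I`:
`f(x + h) - f(x) - Σ_i (∂_i f)(x) · h_i ∈ I²`. [folklore] -/
theorem aeval_add_sub_sub_sum_mem_sq {σ R A : Type*} [Fintype σ] [CommRing R] [CommRing A]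
    [Algebra R A] (I : Ideal A) (x h : σ → A) (hh : ∀ i, h i ∈ I) (f : MvPolynomial σ R) :
    aeval (x + h) f - aeval x f - ∑ i, aeval x (pderiv i f) * h i ∈ I ^ 2 := by
  classical
  induction f using MvPolynomial.induction_on with
  | C a => simp
  | add p q hp hq =>
    have key : aeval (x + h) (p + q) - aeval x (p + q) - ∑ i, aeval x (pderiv i (p + q)) * h i
        = (aeval (x + h) p - aeval x p - ∑ i, aeval x (pderiv i p) * h i)
          + (aeval (x + h) q - aeval x q - ∑ i, aeval x (pderiv i q) * h i) := by
      simp only [map_add, add_mul, Finset.sum_add_distrib]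
      ring
    rw [key]
    exact add_mem hp hq
  | mul_X p k hp =>
    have hD : ∑ i, aeval x (pderiv i p) * h i ∈ I :=
      I.sum_mem fun i _ => I.mul_mem_left _ (hh i)
    have hAB : aeval (x + h) p - aeval x p ∈ I := by
      have := add_mem (Ideal.pow_le_self two_ne_zero hp) hD
      simpa using this
    have hsum : ∑ i, aeval x (pderiv i (p * X k)) * h i
        = (∑ i, aeval x (pderiv i p) * h i) * x k + aeval x p * h k := by
      have hterm : ∀ i, aeval x (pderiv i (p * X k)) * h i
          = aeval x (pderiv i p) * h i * x k
            + aeval x p * Pi.single (M := fun _ => A) k (h k) i := by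
        intro i
        rw [pderiv_mul, map_add, map_mul, map_mul, aeval_X, add_mul]
        congr 1
        · ring
        · by_cases hik : i = k
          · subst hik
            simp
          · rw [pderiv_X_of_ne (Ne.symm hik), Pi.single_eq_of_ne hik, map_zero, mul_zero,
              zero_mul]
      simp_rw [hterm]
      rw [Finset.sum_add_distrib, ← Finset.sum_mul, ← Finset.mul_sum, Finset.sum_pi_single']
      simp
    have key : aeval (x + h) (p * X k) - aeval x (p * X k)
          - ∑ i, aeval x (pderiv i (p * X k)) * h i
        = (aeval (x + h) p - aeval x p - ∑ i, aeval x (pderiv i p) * h i) * x k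
          + (aeval (x + h) p - aeval x p) * h k := by
      rw [hsum, map_mul, map_mul, aeval_X, aeval_X, Pi.add_apply]
      ring
    rw [key, pow_two]
    exact add_mem (Ideal.mul_mem_right _ _ (pow_two I ▸ hp)) (Ideal.mul_mem_mul hAB (hh k))

/-- In `ℤ/p^{2j}` the element `p^j` squares to zero. [folklore] -/
theorem pow_prime_pow_sq_eq_zero (p j : ℕ) :
    ((p : ZMod (p ^ (2 * j))) ^ j) ^ 2 = 0 := by
  rw [← pow_mul, mul_comm j 2, ← Nat.cast_pow, ZMod.natCast_self]

/-- Kernel of the reduction `ℤ/p^{2j} → ℤ/p^j`: an element reducing to `0` is a multiple of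
`p^j`. [folklore] -/
theorem exists_eq_pow_mul_of_redPow_eq_zero {p : ℕ} [hp : Fact p.Prime] {j : ℕ}
    (z : ZMod (p ^ (2 * j))) (hz : redPow p j (2 * j) (by omega) z = 0) :
    ∃ t : ZMod (p ^ (2 * j)), z = (p : ZMod (p ^ (2 * j))) ^ j * t := by
  haveI : NeZero (p ^ (2 * j)) := ⟨pow_ne_zero _ hp.out.ne_zero⟩
  rw [redPow, ZMod.castHom_apply, ZMod.cast_eq_val, ZMod.natCast_eq_zero_iff] at hz
  obtain ⟨t, ht⟩ := hz
  refine ⟨(t : ZMod (p ^ (2 * j))), ?_⟩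
  rw [← Nat.cast_pow, ← Nat.cast_mul, ← ht, ZMod.natCast_zmod_val]

open MvPolynomial in
/-- **The phase is constant on a critical fibre** (the heart of Theorem 1.8 (a), `m = 2j`):
if `x' ≡ x (mod p^j)` coordinatewise and all `∂_i f` vanish at `x̄ = x mod p^j`, then
`f(x') = f(x)` in `ℤ/p^{2j}`. [cite: DabrowskiFisher1997, Thm 1.8 (a)] -/
theorem aeval_eq_aeval_of_critical {p : ℕ} [hp : Fact p.Prime] {n j : ℕ}
    (f : MvPolynomial (Fin n) ℤ) (x x' : Fin n → ZMod (p ^ (2 * j)))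
    (hcrit : ∀ i : Fin n, aeval (fun k => redPow p j (2 * j) (by omega) (x k)) (pderiv i f) = 0)
    (hx' : ∀ i, redPow p j (2 * j) (by omega) (x' i) = redPow p j (2 * j) (by omega) (x i)) :
    aeval x' f = aeval x f := by
  set red := redPow p j (2 * j) (by omega) with hred
  set c : ZMod (p ^ (2 * j)) := (p : ZMod (p ^ (2 * j))) ^ j with hc
  set I : Ideal (ZMod (p ^ (2 * j))) := Ideal.span {c} with hI
  have hI2 : I ^ 2 = ⊥ := by
    rw [hI, Ideal.span_singleton_pow, Ideal.span_singleton_eq_bot, hc]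
    exact pow_prime_pow_sq_eq_zero p j
  have hker : ∀ z, red z = 0 → z ∈ I := by
    intro z hz
    obtain ⟨t, rfl⟩ := exists_eq_pow_mul_of_redPow_eq_zero z hz
    exact Ideal.mul_mem_right _ _ (Ideal.mem_span_singleton_self c)
  -- the step `h = x' - x` lies in `I` coordinatewise
  have hh : ∀ i, (x' - x) i ∈ I := fun i =>
    hker _ (by rw [Pi.sub_apply, map_sub, hx' i, sub_self])
  -- the gradient at `x` lies in `I` coordinatewise (criticality of `x̄`)
  have hder : ∀ i, aeval x (pderiv i f) ∈ I := by
    intro i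
    refine hker _ ?_
    rw [← hcrit i]
    exact MvPolynomial.comp_aeval_apply x red.toIntAlgHom (pderiv i f)
  have htaylor := aeval_add_sub_sub_sum_mem_sq I x (x' - x) hh f
  have hlin : ∑ i, aeval x (pderiv i f) * (x' - x) i ∈ I ^ 2 :=
    Ideal.sum_mem _ fun i _ => by rw [pow_two]; exact Ideal.mul_mem_mul (hder i) (hh i)
  rw [hI2, Ideal.mem_bot] at htaylor hlin
  rw [hlin, sub_zero, add_sub_cancel, sub_eq_zero] at htaylor
  exact htaylor

/-- Every fibre of the reduction `ℤ/p^{2j} → ℤ/p^j` has exactly `p^j` elements. [folklore] -/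
theorem card_filter_redPow_eq {p : ℕ} [hp : Fact p.Prime] (j : ℕ) (a : ZMod (p ^ j)) :
    (Finset.univ.filter fun z : ZMod (p ^ (2 * j)) => redPow p j (2 * j) (by omega) z = a).card
      = p ^ j := by
  classical
  set red := redPow p j (2 * j) (by omega) with hred
  have hsurj : Function.Surjective red := ZMod.castHom_surjective _
  have htot : (Finset.univ : Finset (ZMod (p ^ (2 * j)))).card
      = ∑ b : ZMod (p ^ j), (Finset.univ.filter fun z : ZMod (p ^ (2 * j)) => red z = b).card :=
    Finset.card_eq_sum_card_fiberwise fun z _ => Finset.mem_coe.mpr (Finset.mem_univ (red z))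
  rw [Finset.sum_congr rfl fun b _ =>
      AddMonoidHom.card_fiber_eq_of_mem_range red (hsurj b) (hsurj a),
    Finset.sum_const, Finset.card_univ, Finset.card_univ, ZMod.card, ZMod.card, smul_eq_mul] at htot
  have h2 : p ^ j * p ^ j
      = p ^ j * (Finset.univ.filter fun z : ZMod (p ^ (2 * j)) => red z = a).card := by
    rwa [← pow_add, ← two_mul]
  exact (Nat.eq_of_mul_eq_mul_left (pow_pos hp.out.pos j) h2).symm

open Classical in
/-- The fibre of `(ℤ/p^{2j})ⁿ → (ℤ/p^j)ⁿ` over the reduction of `x` has `p^{nj}` points.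
[folklore] -/
theorem card_fibre_eq_pow {p : ℕ} [hp : Fact p.Prime] (n j : ℕ)
    (x : Fin n → ZMod (p ^ (2 * j))) :
    (Finset.univ.filter fun x' : Fin n → ZMod (p ^ (2 * j)) =>
        ∀ i, redPow p j (2 * j) (by omega) (x' i) = redPow p j (2 * j) (by omega) (x i)).card
      = p ^ (n * j) := by
  have hS : (Finset.univ.filter fun x' : Fin n → ZMod (p ^ (2 * j)) =>
        ∀ i, redPow p j (2 * j) (by omega) (x' i) = redPow p j (2 * j) (by omega) (x i))
      = Fintype.piFinset fun i => Finset.univ.filter fun z : ZMod (p ^ (2 * j)) =>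
          redPow p j (2 * j) (by omega) z = redPow p j (2 * j) (by omega) (x i) := by
    ext x'
    simp only [Finset.mem_filter, Finset.mem_univ, true_and, Fintype.mem_piFinset]
  rw [hS, Fintype.card_piFinset]
  simp only [card_filter_redPow_eq]
  rw [Finset.prod_const, Finset.card_univ, Fintype.card_fin, ← pow_mul, mul_comm]

open Classical MvPolynomial in
/-- **Dąbrowski–Fisher 1997, Theorem 1.8 (a), case `m = 2j`, for `V = 𝔸ⁿ_ℤ`** — discharge of
the named fact `DabrowskiFisher1997_even`: over a critical point `x̄ ∈ (ℤ/p^j)ⁿ` of `f`, the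
fibre sum is `S_x̄ = p^{nj} · e(f(x)/p^{2j})` for any lift `x` of `x̄`.  Proof as printed
(Taylor expansion to second order; the fibre has `p^{nj}` points).
[cite: DabrowskiFisher1997, Thm 1.8 (a)] -/
theorem DabrowskiFisher1997_even_holds : DabrowskiFisher1997_even := by
  intro p hp n j _hj f x hcrit
  have hconst : ∀ x' ∈ (Finset.univ.filter fun x' : Fin n → ZMod (p ^ (2 * j)) =>
      ∀ i, redPow p j (2 * j) (by omega) (x' i) = redPow p j (2 * j) (by omega) (x i)),
      eZMod (p ^ (2 * j)) (aeval x' f) = eZMod (p ^ (2 * j)) (aeval x f) := by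
    intro x' hx'
    rw [aeval_eq_aeval_of_critical f x x' hcrit (Finset.mem_filter.mp hx').2]
  rw [Finset.sum_congr rfl hconst, Finset.sum_const, card_fibre_eq_pow, nsmul_eq_mul, Nat.cast_pow]

end Literature.NumberTheory.GaussSums
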